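import Mathlib
import HarnessLib
import Summits.HubbardSuperconductivity.HubbardSuperconductivity.Theorems.KLProgrammeKLRegimeSplitBundleV15
import Summits.HubbardSuperconductivity.HubbardSuperconductivity.Theorems.KLProgrammeKLRegimeSplitTwoLegCoreTMomentum
import Summits.HubbardSuperconductivity.HubbardSuperconductivity.Theorems.KLProgrammeKLRegimeSplitTwoLegMomentsFromGrid

/-!
# Route `KLProgramme` — GEN-6 two-leg slot (`klPredsV15`, plan g14 (R12)): the V15-NATIVE scale-0 closers — capped (E3c)
# `FrameLipschitzFnTD … K 0` from responses against CAPPED comparison frames, and `TwoLegCoreTD … K 0` for a capped frame with NO aliasing term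

Cell `gate-hubbard-kl`, seat p1b (g7).  Gen 6 repairs F2 (memo SCALE0-TWOLEG-EXPORTS.md) by the degree cap: `FrameOKDeg R U N μ K := FrameOK … ∧
K.degree ≤ klFrameDeg N`, and the (E3c) comparison class becomes `FrameOKDeg` (`FrameLipschitzFnTD`, `TwoLegCoreTD`, `…SplitBundleV15`, p2 g9).  At every
engine volume `klEngL₃ β U ≤ L` a capped frame has `degree ≤ L/2` (`FrameOKDeg.degree_le_half`) and is reproduced exactly by the symmetrised interpolant
(`…SymInterpExact`), so for the two-leg stubs of the gen-6 ENGINE child (K-binder `FrameOKDeg … K`):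

* **`frameLipschitzFnTD_zero_of_responses`** — the scale-0 capped (E3c) from the gradient `b₀` of `S₀ᴷ − K` and a response modulus `ρ₀` against the
  CAPPED comparison frames only (the class F2's witness is excluded from), fit `ρ₀ + b₀/klCurveD ≤ lipBar G Q U 0`;
* **`twoLegCoreTD_zero_of_momentumSizes_degCap`** — `TwoLegCoreTD hist G P Q R β U μ K 0` for `FrameOKDeg … K`, `klEngL₃ β U ≤ L`, from the momentum-side
  sizes `mₖ ≥ ‖Dᵏ evalM (symInterp L (σ₀ − K∘p))‖` (k ≤ 2, any bridge: `…MomentsOffDiag`, `…MomentsFromGrid`), the capped response `ρ₀`, the field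
  strength on the shell, and three fits — NO aliasing sizes (`aₖ = 0` by exact reproduction);
* **`scaleZero_response_capped_of_grid`** — the capped `ρ₀` from grid elements representing `(𝒱⁽⁰⁾_K − 𝒩_K) − (𝒱⁽⁰⁾_{K'} − 𝒩_{K'})`
  (`abs_scaleZero_response_le_of_grid`; both frames band-limited at `L` by the cap and the Nyquist guard);
* `twoLegCoreTD_succ_of_momentumSizes` — at `n + 1` the V14 closer composed with `twoLegCoreTD_of_coreT` (the raw (E3c) implies the capped one).

Proofs only; nothing about the model is asserted.  References: BGM 2006 §2.4 (2.36) [cite: BenfattoGiulianiMastropietro2006].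
-/

noncomputable section

namespace Summit.HubbardSuperconductivity.HubbardSuperconductivity.Theorems.KLRegimeSplit

set_option linter.dupNamespace false -- summit = problem name (single-conjunct summit), D-0017

open Real Finset
open Literature.MathematicalPhysics.QuantumLattice Literature.MathematicalPhysics.QuantumLattice.BandSectorCounting
open Literature.Probability.LatticeModels
open Summit.HubbardSuperconductivity.HubbardSuperconductivity.Theorems.DispersionFlow
open Summit.HubbardSuperconductivity.HubbardSuperconductivity.Theorems.PerturbedFermiCurve
open Summit.HubbardSuperconductivity.HubbardSuperconductivity.Theorems.KLProgrammeLegKernels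
open Summit.HubbardSuperconductivity.HubbardSuperconductivity.Theorems.TwoLegFourier
open Summit.HubbardSuperconductivity.HubbardSuperconductivity.Theorems.EngineV8

variable {L M : ℕ} [NeZero L] [NeZero M]

/-! ## §1 The capped scale-0 (E3c) -/

/-- **Capped (E3c) for `ℓ_0`, NAMED thresholds**: gradient `b₀` of `evalM S₀ᴷ − evalM K`, response modulus `ρ₀` of `T^K = S₀ᴷ − K` against every CAPPED
admissible `K′` (`FrameOKDeg`), fit `ρ₀ + b₀/klCurveD ≤ lipBar G Q U 0` ⇒ `FrameLipschitzFnTD … K 0`. -/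
theorem frameLipschitzFnTD_zero_of_responses {R : RenConsts} (hR : ∀ j, 0 ≤ R.Gfr j) {c : ℝ} (hc : 0 < c)
    (hcle : c ≤ klCurveC3 R) {U : ℝ} (hU : 0 < U) (hUle : U ≤ klCurveU0 R) {β : ℝ} (hβmin : klBetaMin ≤ β)
    (hβc : β ≤ Real.exp (c / U ^ 2)) {μ : ℝ} (hμ : μ ∈ klWindowC) {K : TrigPolyC4v} (hK : FrameOK R U (nScales β) μ K)
    (hist : TrigPolyC4v → ℕ → Prop) (G : GeoConsts) (Q : EngConsts) {b₀ ρ₀ : ℝ} (hb₀ : 0 ≤ b₀)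
    (hg₀ : ∀ q : Momentum, ‖fderiv ℝ (fun q : Momentum =>
      evalM (symInterp L (klLocSelfEnergyRe L M β U μ K 0)) q - evalM K q) q‖ ≤ b₀)
    (hr₀ : ∀ K' : TrigPolyC4v, FrameOKDeg R U (klTempScaleIdx β klE0) μ K' → ∀ θ : ℝ,
      |((symInterp L (klLocSelfEnergyRe L M β U μ K 0)).eval (klFermiPoint μ K' θ) - K.eval (klFermiPoint μ K' θ)) -
        ((symInterp L (klLocSelfEnergyRe L M β U μ K' 0)).eval (klFermiPoint μ K' θ) - K'.eval (klFermiPoint μ K' θ))| ≤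
        ρ₀ * frameDist K K')
    (hfit : ρ₀ + b₀ / klCurveD ≤ lipBar G Q U 0) :
    FrameLipschitzFnTD L M hist G Q R β U μ K 0 := by
  intro K' hK' _ q
  have ha : (-4 : ℝ) < -1.1 := by norm_num
  have hab : (-1.1 : ℝ) ≤ -0.1 := by norm_num
  have hb : (-0.1 : ℝ) < 0 := by norm_num
  obtain ⟨hAf, hA20, hADt, hhalf, ⟨hlo, hhi⟩, -, -⟩ := frame_sizes_of_frameOK_explicit hR hc hcle hU hUle hβmin hβc hμ hK
  obtain ⟨hAf', -, -, -, -, -, -⟩ := frame_sizes_of_frameOK_explicit hR hc hcle hU hUle hβmin hβc hμ hK'.1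
  set A := 2 * R.Gfr 0 * |U| + 2 * R.Gfr 1 * U ^ 2 + R.Gfr 2 * (c / Real.log 4) with hAdef
  have hA0 : 0 ≤ A := le_trans (norm_nonneg _) (hAf 0 0 (by norm_num))
  have hbd := abs_klTwoLegPieceFn_eval_zero_sub_le_sharp (bandBounds ha hab hb) hAf hAf' hADt hlo hhi hb₀ hg₀ (hr₀ K' hK') q
  have hfd : 0 ≤ frameDist K K' := frameDist_nonneg K K'
  have hDpos : 0 < klCurveD := by unfold klCurveD; linarith [cDtmin_window_ge]
  have hden : frameDist K K' / ((bandBounds ha hab hb).Dtmin - A) ≤ frameDist K K' / klCurveD :=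
    div_le_div_of_nonneg_left hfd hDpos (by linarith)
  have h1 : ρ₀ * frameDist K K' + b₀ * (frameDist K K' / klCurveD) = (ρ₀ + b₀ / klCurveD) * frameDist K K' := by ring
  calc _ ≤ ρ₀ * frameDist K K' + b₀ * (frameDist K K' / ((bandBounds ha hab hb).Dtmin - A)) := hbd
    _ ≤ ρ₀ * frameDist K K' + b₀ * (frameDist K K' / klCurveD) := by nlinarith [mul_le_mul_of_nonneg_left hden hb₀]
    _ = (ρ₀ + b₀ / klCurveD) * frameDist K K' := h1
    _ ≤ lipBar G Q U 0 * frameDist K K' := mul_le_mul_of_nonneg_right hfit hfd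

/-! ## §2 `TwoLegCoreTD … K 0` for a capped frame: no aliasing term -/

/-- **`TwoLegCoreTD hist … K 0` for a CAPPED frame at an engine volume, from momentum-side sizes** (`aₖ = 0` by exact reproduction; capped (E3c)). -/
theorem twoLegCoreTD_zero_of_momentumSizes_degCap {R : RenConsts} (hR : ∀ j, 0 ≤ R.Gfr j) {c : ℝ} (hc : 0 < c)
    (hcle : c ≤ klCurveC3 R) {U : ℝ} (hU : 0 < U) (hUle : U ≤ klCurveU0 R) {β : ℝ} (hβmin : klBetaMin ≤ β)
    (hβc : β ≤ Real.exp (c / U ^ 2)) {μ : ℝ} (hμ : μ ∈ klWindowC) {K : TrigPolyC4v} (hKD : FrameOKDeg R U (nScales β) μ K)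
    (hL : klEngL₃ β U ≤ L) (hist : TrigPolyC4v → ℕ → Prop) (G : GeoConsts) (P : SplitConsts) (Q : EngConsts)
    {m : ℕ → ℝ}
    (hm : ∀ k ≤ 2, ∀ p : Momentum, ‖iteratedFDeriv ℝ k
      (evalM (symInterp L (fun q => klLocSelfEnergyRe L M β U μ K 0 q - K.eval (latticeMomentum L q)))) p‖ ≤ m k)
    (hfitS : ∀ j ≤ 2, (if j = 0 then m 0 else 0) +
      (j.factorial : ℝ) ^ 2 * (2 * j.factorial * 1110 * 200 ^ j) *
        (if j = 0 then 2 * m 0 else (2 * π + 1) * (m 1 * klCurveD1) + (if j = 2 then m 2 * klCurveD1 ^ 2 + m 1 * klCurveD2 else 0)) *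
        (4 + max 1 (((j - 1).factorial : ℝ) / (8 / 5))) ^ j ≤ twoLegBar G Q U j 0)
    {ρ₀ : ℝ}
    (hr₀ : ∀ K' : TrigPolyC4v, FrameOKDeg R U (klTempScaleIdx β klE0) μ K' → ∀ θ : ℝ,
      |((symInterp L (klLocSelfEnergyRe L M β U μ K 0)).eval (klFermiPoint μ K' θ) - K.eval (klFermiPoint μ K' θ)) -
        ((symInterp L (klLocSelfEnergyRe L M β U μ K' 0)).eval (klFermiPoint μ K' θ) - K'.eval (klFermiPoint μ K' θ))| ≤
        ρ₀ * frameDist K K')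
    (hfitL : ρ₀ + m 1 / klCurveD ≤ lipBar G Q U 0)
    (hz : ∀ k ∈ klShell L μ K 0, |klFieldStrength L M β U μ K 0 k - 1| ≤ R.cz * |U|)
    (hfit1 : m 1 + 4 / 3 * R.Gfr 1 * U ^ 2 ≤ R.cz * |U| * (cDtmin (-1.2) (-0.05) / 2)) :
    TwoLegCoreTD L M hist G P Q R β U μ K 0 := by
  have hK : FrameOK R U (nScales β) μ K := hKD.1
  have hdeg : K.degree ≤ L / 2 := hKD.degree_le_half rfl hβmin hL
  -- no aliasing for a capped frame at an engine volume
  have ha : ∀ k ≤ 2, ∀ p : Momentum, ‖iteratedFDeriv ℝ k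
      (fun p : Momentum => evalM (symInterp L (fun q => K.eval (latticeMomentum L q))) p - evalM K p) p‖ ≤ (fun _ : ℕ => (0 : ℝ)) k :=
    fun k _ p => by rw [iteratedFDeriv_symInterp_latticeValues_sub_eq_zero L K hdeg k p, norm_zero]
  -- the V14 closer with `a = 0` gives tier 1 and the slopes; its raw (E3c) is not used
  have ha' : (-4 : ℝ) < -1.1 := by norm_num
  have hab : (-1.1 : ℝ) ≤ -0.1 := by norm_num
  have hb : (-0.1 : ℝ) < 0 := by norm_num
  obtain ⟨hAf, hA20, hADt, -, ⟨hlo, hhi⟩, -, -⟩ := frame_sizes_of_frameOK_explicit hR hc hcle hU hUle hβmin hβc hμ hK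
  have hgrad := fun q => norm_fderiv_scaleZero_reading_le_sep (L := L) (M := M) (hm 1 (by norm_num)) (ha 1 (by norm_num)) q
  have hb₀ : 0 ≤ m 1 := by have h := (hgrad 0).1; simp only [add_zero] at h; exact (norm_nonneg _).trans h
  have h0 : ContDiff ℝ 4 (klLocalPart L M β U μ K 0) := contDiff_klLocalPart (bandBounds ha' hab hb) hAf hADt hlo hhi L M β U 0
  have hKc : ContDiff ℝ 4 (fun θ => K.eval (klFermiPoint μ K θ)) := contDiff_eval_klFermiPoint (bandBounds ha' hab hb) hAf hADt hlo hhi K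
  refine ⟨⟨?_, fun j hj q => ?_⟩, ?_, ?_⟩
  · have hP := klTwoLegPieceFn_eval_zero (L := L) (M := M) β U μ K h0.continuous hKc.continuous
    have hδ : ContDiff ℝ (4 : ℕ∞) (fun θ => klLocalPart L M β U μ K 0 θ - K.eval (klFermiPoint μ K θ)) := by
      exact_mod_cast h0.sub hKc
    have hper : Function.Periodic (fun θ => klLocalPart L M β U μ K 0 θ - K.eval (klFermiPoint μ K θ)) (2 * π) := fun θ => by
      simp only [klLocalPart_periodic β U μ K 0 θ, frameOnCurve_periodic μ K θ]
    exact_mod_cast contDiff_onM_piece hP hδ hper hμ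
  · have h := twoLegPieceFn_eval_zero_tier1_size_le_sep (L := L) (M := M) hR hc hcle hU hUle hβmin hβc hμ hK hm ha hj
      (fun l hl x => norm_iteratedFDeriv_salmhoferCutoff_le_of_le_two (hl.trans hj) x) q
    simp only [add_zero] at h
    exact h.trans (hfitS j hj)
  · refine frameLipschitzFnTD_zero_of_responses (L := L) (M := M) hR hc hcle hU hUle hβmin hβc hμ hK hist G Q hb₀ (fun q => ?_) hr₀ hfitL
    have h := (hgrad q).1
    simpa only [add_zero] using h
  · have haw : (-4 : ℝ) < -1.2 := by norm_num
    have habw : (-1.2 : ℝ) ≤ -0.05 := by norm_num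
    have hbw : (-0.05 : ℝ) < 0 := by norm_num
    set B := bandBounds haw habw hbw with hBdef
    have hBD : B.Dtmin = cDtmin (-1.2) (-0.05) := rfl
    have hAfw : ∀ p : Momentum, ∀ j ≤ 2, ‖iteratedFDeriv ℝ j (frameShift K) p‖ ≤
        2 * R.Gfr 0 * |U| + 2 * R.Gfr 1 * U ^ 2 + R.Gfr 2 * (c / Real.log 4) := fun p j hj =>
      norm_iteratedFDeriv_frameShift_le_of_frameOK_regime hR hc.le hβmin hβc hK p hj
    obtain ⟨hA20w, hADtw, hhalf⟩ := two_frameSize_lt_cDtmin_wide hR hc.le hcle hU hUle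
    have hADt' : 2 * (2 * R.Gfr 0 * |U| + 2 * R.Gfr 1 * U ^ 2 + R.Gfr 2 * (c / Real.log 4)) < B.Dtmin := by rw [hBD]; exact hADtw
    obtain ⟨hloΛ, hhiΛ⟩ := klWindowC_shell_margin hμ hA20w (klScale_klE0_le_klE0 0)
    have h13 : 0 ≤ 4 / 3 * R.Gfr 1 * U ^ 2 := by have := hR 1; positivity
    have hczU : 0 ≤ R.cz * |U| := by
      by_contra hneg
      have hneg' : R.cz * |U| < 0 := lt_of_not_ge hneg
      have : R.cz * |U| * (cDtmin (-1.2) (-0.05) / 2) < 0 := mul_neg_of_neg_of_pos hneg' (by linarith [cDtmin_wide_ge])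
      linarith
    set bS : ℝ := m 1 + 4 / 3 * R.Gfr 1 * U ^ 2 with hbS
    have hbS0 : 0 ≤ bS := by positivity
    have hgradS : ∀ q : Momentum, ‖fderiv ℝ (evalM (symInterp L (klLocSelfEnergyRe L M β U μ K 0))) q‖ ≤ bS := fun q => by
      have h := (hgrad q).2
      simp only [add_zero] at h
      exact h.trans (by rw [hbS]; linarith [norm_iteratedFDeriv_one_frameShift_le_of_frameOK hR hK q])
    have hb' : bS ≤ R.cz * |U| * (B.Dtmin - 2 * (2 * R.Gfr 0 * |U| + 2 * R.Gfr 1 * U ^ 2 + R.Gfr 2 * (c / Real.log 4))) :=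
      hfit1.trans (mul_le_mul_of_nonneg_left (by rw [hBD]; exact hhalf) hczU)
    exact twoLegSlopes_of_fieldStrength_of_gradient B hAfw hADt' hloΛ hhiΛ (selfEnergySymmetric_all L M β U μ K 0) hz hbS0 hgradS hb'

/-! ## §3 The capped response from grid elements; scale `n + 1` -/

/-- **The capped scale-0 response `ρ₀` from grid elements**: if for every CAPPED comparison frame `K′` the difference
`(𝒱⁽⁰⁾_K − 𝒩_K) − (𝒱⁽⁰⁾_{K′} − 𝒩_{K′})` is `map S (W K′)` with pinned grid sums `≤ ρ·frameDist K K′`, then (for capped `K`, engine volume)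
the `hr₀` hypothesis of the capped closers holds with `ρ₀ = (2|P|/(|β|L²))·ρ`. -/
theorem scaleZero_response_capped_of_grid {P : Type*} [Fintype P] [DecidableEq P] {R : RenConsts} {U β μ : ℝ} (hβmin : klBetaMin ≤ β)
    {K : TrigPolyC4v} (hKD : FrameOKDeg R U (nScales β) μ K) (hL : klEngL₃ β U ≤ L) (x : P → TorusSite 2 L) (τ : P → ℝ)
    (W : TrigPolyC4v → GrassmannAlgebra ℂ (GridLeg P))
    (hW : ∀ K' : TrigPolyC4v, FrameOKDeg R U (klTempScaleIdx β klE0) μ K' →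
      (klEffectiveAction L M β U μ K klE0 0 - counterQuadratic L M β K) -
          (klEffectiveAction L M β U μ K' klE0 0 - counterQuadratic L M β K') =
        ExteriorAlgebra.map (Matrix.toLin' (gridSubMatrix L M β x τ)) (W K'))
    {ρ : ℝ} (hρ : ∀ K' : TrigPolyC4v, FrameOKDeg R U (klTempScaleIdx β klE0) μ K' →
      ∀ (σ : Fin 2) (p₀ : P), ∑ p₁ : P, ‖kernel ℂ (W K') 2 (fun i => ((![p₀, p₁] i, σ), i))‖ ≤ ρ * frameDist K K') :
    ∀ K' : TrigPolyC4v, FrameOKDeg R U (klTempScaleIdx β klE0) μ K' → ∀ θ : ℝ,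
      |((symInterp L (klLocSelfEnergyRe L M β U μ K 0)).eval (klFermiPoint μ K' θ) - K.eval (klFermiPoint μ K' θ)) -
        ((symInterp L (klLocSelfEnergyRe L M β U μ K' 0)).eval (klFermiPoint μ K' θ) - K'.eval (klFermiPoint μ K' θ))| ≤
        2 * (Fintype.card P : ℝ) / (|β| * (L : ℝ) ^ 2) * ρ * frameDist K K' := by
  intro K' hK' θ
  have hβ : 0 < β := lt_of_lt_of_le (by unfold klBetaMin; norm_num) hβmin
  have hdeg : K.degree ≤ L / 2 := hKD.degree_le_half rfl hβmin hL
  have hdeg' : K'.degree ≤ L / 2 := degree_le_half_of_klEngL₃_le hβmin hL hK'.degree_le_nScales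
  have h := abs_scaleZero_response_le_of_grid (L := L) (M := M) hβ.ne' U μ K K' (bandLimited_of_degree_le L K hdeg)
    (bandLimited_of_degree_le L K' hdeg') x τ (W K') (hW K' hK') (hρ K' hK') (klFermiPoint μ K' θ)
  simpa only [mul_assoc] using h

/-- **`TwoLegCoreTD … K (n+1)` from momentum-side sizes** = the V14 closer composed with `twoLegCoreTD_of_coreT` (at `n ≥ 1` the raw (E3c) is
satisfiable and implies the capped one). -/
theorem twoLegCoreTD_succ_of_momentumSizes {R : RenConsts} (hR : ∀ j, 0 ≤ R.Gfr j) {c : ℝ} (hc : 0 < c)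
    (hcle : c ≤ klCurveC3 R) {U : ℝ} (hU : 0 < U) (hUle : U ≤ klCurveU0 R) {β : ℝ} (hβmin : klBetaMin ≤ β)
    (hβc : β ≤ Real.exp (c / U ^ 2)) {μ : ℝ} (hμ : μ ∈ klWindowC) {K : TrigPolyC4v} (hK : FrameOK R U (nScales β) μ K)
    (hist : TrigPolyC4v → ℕ → Prop) (G : GeoConsts) (P : SplitConsts) (Q : EngConsts) (n : ℕ)
    {Mv : ℕ → ℝ}
    (hM : ∀ k ≤ 2, ∀ p : Momentum, ‖iteratedFDeriv ℝ k
      (evalM (symInterp L fun q => klLocSelfEnergyRe L M β U μ K (n + 1) q - klLocSelfEnergyRe L M β U μ K n q)) p‖ ≤ Mv k)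
    (hfitS : ∀ j ≤ 2, (if j = 0 then Mv 0 else 0) +
      (j.factorial : ℝ) ^ 2 * (2 * j.factorial * 1110 * 200 ^ j) *
        (if j = 0 then 2 * Mv 0 else (2 * π + 1) * (Mv 1 * klCurveD1) + (if j = 2 then Mv 2 * klCurveD1 ^ 2 + Mv 1 * klCurveD2 else 0)) *
        (4 + max 1 (((j - 1).factorial : ℝ) / (8 / 5))) ^ j ≤ twoLegBar G Q U j (n + 1))
    {ρΔ : ℝ}
    (hr : ∀ K' : TrigPolyC4v, FrameOK R U (klTempScaleIdx β klE0) μ K' → (∀ j < n + 1, hist K' j) → ∀ θ : ℝ,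
      |((symInterp L (klLocSelfEnergyRe L M β U μ K (n + 1))).eval (klFermiPoint μ K' θ) -
          (symInterp L (klLocSelfEnergyRe L M β U μ K n)).eval (klFermiPoint μ K' θ)) -
        ((symInterp L (klLocSelfEnergyRe L M β U μ K' (n + 1))).eval (klFermiPoint μ K' θ) -
          (symInterp L (klLocSelfEnergyRe L M β U μ K' n)).eval (klFermiPoint μ K' θ))| ≤ ρΔ * frameDist K K')
    (hfitL : ρΔ + Mv 1 / klCurveD ≤ lipBar G Q U (n + 1))
    {m₁' a₁ : ℝ}
    (hm₁' : ∀ p : Momentum, ‖iteratedFDeriv ℝ 1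
      (evalM (symInterp L (fun q => klLocSelfEnergyRe L M β U μ K (n + 1) q - K.eval (latticeMomentum L q)))) p‖ ≤ m₁')
    (ha₁ : ∀ p : Momentum, ‖iteratedFDeriv ℝ 1
      (fun p : Momentum => evalM (symInterp L (fun q => K.eval (latticeMomentum L q))) p - evalM K p) p‖ ≤ a₁)
    (hz : ∀ k ∈ klShell L μ K (n + 1), |klFieldStrength L M β U μ K (n + 1) k - 1| ≤ R.cz * |U|)
    (hfit1 : m₁' + a₁ + 4 / 3 * R.Gfr 1 * U ^ 2 ≤ R.cz * |U| * (cDtmin (-1.2) (-0.05) / 2)) :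
    TwoLegCoreTD L M hist G P Q R β U μ K (n + 1) :=
  twoLegCoreTD_of_coreT (twoLegCoreT_succ_of_momentumSizes (L := L) (M := M) hR hc hcle hU hUle hβmin hβc hμ hK hist G P Q n hM hfitS
    hr hfitL hm₁' ha₁ hz hfit1)

end Summit.HubbardSuperconductivity.HubbardSuperconductivity.Theorems.KLRegimeSplit

end
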